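import Literature.AlgebraicGeometry.Frobenioids.CircleOpensArcs
import HarnessLib

/-!
# Frobenioids II, Lemma 3.2: proof of (v)

Mochizuki, *The geometry of Frobenioids II*, Kyushu J. Math. **62** (2008) 401–460, §3, Lemma 3.2
(v) p. 25 [cite: MochizukiFrdII2008, Lem 3.2 (v) p.25]. Discharge (proof-only companion) of the
named fact `ItemV` of `CircleOpens.lean` (abc-iut-L1-t4) from the arc description of connected open
subsets of `S¹` (`CircleOpensArcs.lean`): `A` contains an open arc of some length `ℓ > 0`; for
`|n| > 2π/ℓ` the power map `φ_n` wraps that arc around the whole circle (so `φ_n` is surjective on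
every set containing `A`, and `φ_n(A) = φ_n(B) = S¹`) and identifies two of its points at distance
`2π/|n|` (so it is not injective there); the exceptional set is `E = [-N, N] ∩ ℤ`, `N = ⌈2π/ℓ⌉ + 1`.
-/

namespace Literature.AlgebraicGeometry.Frobenioids

open Set Function Topology Real
open scoped Pointwise

noncomputable section

namespace CircleOpens

/-- `x ↦ c x` for `c < 0` reverses open intervals. [cite: MochizukiFrdII2008, Lem 3.2 (v) p.25] -/
private theorem image_mul_left_Ioo_of_neg {c : ℝ} (hc : c < 0) (a b : ℝ) :
    (fun x => c * x) '' Ioo a b = Ioo (c * b) (c * a) := by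
  ext y
  constructor
  · rintro ⟨x, hx, rfl⟩
    exact ⟨mul_lt_mul_of_neg_left hx.2 hc, mul_lt_mul_of_neg_left hx.1 hc⟩
  · intro hy
    refine ⟨y / c, ⟨?_, ?_⟩, mul_div_cancel₀ _ hc.ne⟩
    · rw [lt_div_iff_of_neg hc]; linarith [hy.2]
    · rw [div_lt_iff_of_neg hc]; linarith [hy.1]

/-- `φ_n` wraps an arc of length `ℓ` around all of `S¹` as soon as `|n| ℓ > 2π`.
[cite: MochizukiFrdII2008, Lem 3.2 (v) p.25] -/
theorem phi_image_exp_image_Ioo_eq_univ {a b : ℝ} {n : ℤ} (hn : 2 * π < |(n : ℝ)| * (b - a)) :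
    phi n '' (Circle.exp '' Ioo a b) = univ := by
  rw [phi_image_exp_image]
  rcases lt_trichotomy (n : ℝ) 0 with hneg | h0 | hpos
  · rw [image_mul_left_Ioo_of_neg hneg, abs_of_neg hneg] at *
    exact exp_image_Ioo_eq_univ (by nlinarith)
  · rw [h0, abs_zero, zero_mul] at hn
    linarith [two_pi_pos]
  · rw [image_mul_left_Ioo hpos]
    rw [abs_of_pos hpos] at hn
    exact exp_image_Ioo_eq_univ (by nlinarith)

/-- Two distinct points of an arc of length `ℓ` identified by `φ_n` when `|n| ℓ > 2π` and `|n| > 1`.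
[cite: MochizukiFrdII2008, Lem 3.2 (v) p.25] -/
theorem exists_pair_phi_eq {a b : ℝ} {n : ℤ} (hn : 2 * π < |(n : ℝ)| * (b - a))
    (hn1 : 1 < |(n : ℝ)|) :
    ∃ z₁ ∈ Circle.exp '' Ioo a b, ∃ z₂ ∈ Circle.exp '' Ioo a b, z₁ ≠ z₂ ∧ phi n z₁ = phi n z₂ := by
  have hnpos : 0 < |(n : ℝ)| := by linarith
  set δ := 2 * π / |(n : ℝ)| with hδ
  have hδpos : 0 < δ := div_pos two_pi_pos hnpos
  have hδlt : δ < b - a := by rw [hδ, div_lt_iff₀ hnpos]; linarith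
  have hδ2π : δ < 2 * π := by
    rw [hδ, div_lt_iff₀ hnpos]; nlinarith [two_pi_pos]
  set x₁ := (a + (b - δ)) / 2 with hx₁
  have hx₁a : a < x₁ := by rw [hx₁]; linarith
  have hx₁b : x₁ + δ < b := by rw [hx₁]; linarith
  refine ⟨Circle.exp x₁, ⟨x₁, ⟨hx₁a, by linarith⟩, rfl⟩, Circle.exp (x₁ + δ),
    ⟨x₁ + δ, ⟨by linarith, hx₁b⟩, rfl⟩, ?_, ?_⟩
  · intro e
    have := Circle.exp_injOn_Ico (a := x₁) (b := x₁ + 2 * π) (by linarith)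
      ⟨le_rfl, by linarith [two_pi_pos]⟩ ⟨by linarith, by linarith⟩ e
    linarith
  · rw [phi_exp, phi_exp, mul_add]
    have hn0 : (n : ℝ) ≠ 0 := by
      intro h; rw [h, abs_zero] at hnpos; exact lt_irrefl _ hnpos
    rcases lt_or_gt_of_ne hn0 with hneg | hpos
    · have : (n : ℝ) * δ = -(2 * π) := by
        rw [hδ, abs_of_neg hneg, div_neg, mul_neg, mul_div_cancel₀ _ hn0]
      rw [this, ← sub_eq_add_neg, Circle.exp_sub_two_pi]
    · have : (n : ℝ) * δ = 2 * π := by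
        rw [hδ, abs_of_pos hpos, mul_div_cancel₀ _ hn0]
      rw [this, Circle.exp_add_two_pi]

/-- **Lemma 3.2 (v)** (FrdII p. 25), PROVED: "There exists a finite subset `E ⊆ ℤ` such that for any
`n ∈ ℤ \ E`, and any `(A, S¹)`-subset `A′`, the restriction of `φ_n` to `A′` is surjective, but not
injective. In particular, for `n ∈ ℤ \ E`, `φ_n(A) = φ_n(B) = S¹`."
[cite: MochizukiFrdII2008, Lem 3.2 (v) p.25] -/
theorem ItemV_holds : ItemV := by
  intro A B hAB
  -- an open arc inside `A`
  obtain ⟨a, b, hab, harc⟩ : ∃ a b : ℝ, a < b ∧ Circle.exp '' Ioo a b ⊆ A := by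
    by_cases hU : A = univ
    · exact ⟨0, 1, one_pos, hU ▸ subset_univ _⟩
    · obtain ⟨c, d, hcd, -, h⟩ := exists_eq_exp_image_Ioo hAB.isConnected_left hAB.isOpen_left hU
      exact ⟨c, d, hcd, h ▸ subset_rfl⟩
  set N : ℕ := ⌈2 * π / (b - a)⌉₊ + 1 with hN
  refine ⟨Finset.Icc (-(N : ℤ)) N, fun n hn => ?_⟩
  -- `n ∉ [-N, N]` means `|n| > N`
  have hnN : (N : ℝ) < |(n : ℝ)| := by
    rw [Finset.mem_Icc, not_and_or, not_le, not_le] at hn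
    rw [← Int.cast_abs]
    have : (N : ℤ) < |n| := by
      rcases hn with h | h
      · rw [abs_of_neg (by omega)]; omega
      · exact lt_of_lt_of_le h (le_abs_self n)
    exact_mod_cast this
  have hceil : 2 * π / (b - a) ≤ (⌈2 * π / (b - a)⌉₊ : ℝ) := Nat.le_ceil _
  have hNreal : (N : ℝ) = ⌈2 * π / (b - a)⌉₊ + 1 := by rw [hN]; push_cast; ring
  have hn1 : 1 < |(n : ℝ)| := by
    have h0 : (0 : ℝ) ≤ (⌈2 * π / (b - a)⌉₊ : ℝ) := Nat.cast_nonneg _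
    have : (1 : ℝ) ≤ N := by rw [hNreal]; linarith
    linarith
  have hlen : 2 * π < |(n : ℝ)| * (b - a) := by
    have hba : 0 < b - a := by linarith
    have h1 : 2 * π / (b - a) < |(n : ℝ)| := by linarith
    rwa [div_lt_iff₀ hba] at h1
  have hAuniv : phi n '' A = univ :=
    univ_subset_iff.mp ((phi_image_exp_image_Ioo_eq_univ hlen).symm.le.trans (image_mono harc))
  refine ⟨fun A' hA' => ⟨?_, ?_⟩, hAuniv, ?_⟩
  · -- surjective on every `A' ⊇ A`
    intro z _
    have hz : z ∈ phi n '' A := hAuniv.symm ▸ mem_univ z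
    obtain ⟨w, hw, rfl⟩ := hz
    exact ⟨w, hA'.2.2.1 hw, rfl⟩
  · -- not injective on `A'`
    intro hinj
    obtain ⟨z₁, hz₁, z₂, hz₂, hne, heq⟩ := exists_pair_phi_eq hlen hn1
    exact hne (hinj (hA'.2.2.1 (harc hz₁)) (hA'.2.2.1 (harc hz₂)) heq)
  · exact univ_subset_iff.mp (hAuniv.symm.le.trans (image_mono hAB.subset))

end CircleOpens

end

end Literature.AlgebraicGeometry.Frobenioids
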